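import Mathlib
import HarnessLib
import Summits.ResolutionOfSingularities.ResolutionOfSingularities.Theorems.WildQuotientsWildQuotientResolutionS1aNodeCentre
import Summits.ResolutionOfSingularities.ResolutionOfSingularities.Theorems.WildQuotientsWildQuotientResolutionS1aModelNodeAtlas

/-!
# S1a — X-scheme MOVE on an abstract model of a node, τ-form: the centre producer with separating sections and the atlas producer

[OURS · L1 W4.5c · lead-1 g13; FRAME-STATUS rev16 §2 (D1)/(D5), §3 «general tool `exists_move_of_node` so that each D₄ move file is algebra only»;
plan-1 CHAIN v10.40 §4 (I-3 = MT-D₄ after I-2)] — NOT statements of the manuscript; counted 0; AI-level work, weaker than expert review. Crux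
stmt-ResolutionOfSingularities-17941 `CyclicQuotientFourfolds`, line `s1a-logminvertex` v13 (`stub_reachLowerInFX`).

The two halves of a move, for a node `DW` on a stable affine chart `W` modelled by `Φ : DW.B ≃+* P` with the action read as an automorphism `τ` of `P`
(`hτ : τ x = Φ (DW.σ (Φ⁻¹ x))`) — the form in which the instance files (✓`a1_move2`, ✓`a1_move3`) state their rows:
* ★★ `exists_isAdmissibleCentre_of_node_sections` — centre producer: a K1′ τ-adapted homogeneous weighted centre `f` in `P` whose zero set on `W` is separated
  from the rest of a cover `M.V = W ∪ ⋃ Uᵢ` by sections `uᵢ ∈ Γ(M, W)` (units on `W ∩ Uᵢ`, `Φ(e uᵢ) ∈ 𝒥_{nᵢ}`, `nᵢ > 0`) is an ADMISSIBLE move (Veronese `d`,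
  `G`-stable, trace formula, `supp ⊆ W`) — ✓`exists_isAdmissibleCentre_of_node` + ✓`closure_zeroLocus_inter_subset_of_cover`;
* ★★ `exists_moveAtlas_of_node_tau` — atlas producer on a realisation in τ-form: ✓`exists_moveAtlas_of_node` for the node `(P, Φ(DW.𝒜), τ, DW.e ≫ Φ|₀)`, the
  tameness / order / intertwining inputs being derived from `DW` and `hτ`.
-/

set_option linter.dupNamespace false

noncomputable section

open CategoryTheory Limits AlgebraicGeometry TopologicalSpace Topology Opposite
open Literature.AlgebraicGeometry.Resolution Literature.AlgebraicGeometry.RelativeSpec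
open scoped LaurentPolynomial
open Summit.ResolutionOfSingularities.ResolutionOfSingularities.Theorems.WildQuotientResolution.S1
open Summit.ResolutionOfSingularities.ResolutionOfSingularities.Theorems.WildQuotientResolution.S1.NodeAtlas
open Summit.ResolutionOfSingularities.ResolutionOfSingularities.Theorems.WildQuotientResolution.S1.CoarseChart
open Summit.ResolutionOfSingularities.ResolutionOfSingularities.Theorems.WildQuotientResolution.S1.ProducerStep
open Summit.ResolutionOfSingularities.ResolutionOfSingularities.Theorems.WildQuotientResolution.S1.NpFrame
open Summit.ResolutionOfSingularities.ResolutionOfSingularities.Theorems.WildQuotientResolution.S1.GoodCharts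
open Summit.ResolutionOfSingularities.ResolutionOfSingularities.Theorems.WildQuotientResolution.S1.BlowupCharts
open Summit.ResolutionOfSingularities.ResolutionOfSingularities.Theorems.WildQuotientResolution.S1.KillableTransport
open Summit.ResolutionOfSingularities.ResolutionOfSingularities.Theorems.WildQuotientResolution.S1.KillCert
open Summit.ResolutionOfSingularities.ResolutionOfSingularities.Theorems.WildQuotientResolution.S1.ReesBigrading
open Summit.ResolutionOfSingularities.ResolutionOfSingularities.Theorems.WildQuotientResolution.S1.NodeTransport
open Summit.ResolutionOfSingularities.ResolutionOfSingularities.Theorems.WildQuotientResolution.BlowupExit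

namespace Summit.ResolutionOfSingularities.ResolutionOfSingularities.Theorems.WildQuotientResolution.S1.GameFrame.GModel

variable {p : ℕ} {X' X₁ : Scheme.{0}} {q : X' ⟶ X₁} {G : Type} [Group G] {ρ : G →* Aut X'} {g₀ : G}

/-- The node `DW` read through `Φ` with the action as `τ`: tame, of order dividing `p`, and `g₀`-intertwining for `e_P = DW.e ≫ Φ|₀`. -/
theorem node_tau_facts {V Y : Scheme.{0}} {r : V ⟶ Y} {ρ' : ActionOver r G} (W : ρ'.StableAffineOpens) (DW : NodeData p ρ' g₀ W)
    {P : Type} [CommRing P] (Φ : letI := DW.instCommRing; DW.B ≃+* P) (τ : P ≃+* P)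
    (hτ : letI := DW.instCommRing; ∀ x : P, τ x = Φ (DW.σ (Φ.symm x))) :
    letI := DW.instCommRing; letI := DW.instGradedRing; letI := mapGradedRing DW.𝒜 Φ
    IsTameNode p P (mapGrading DW.𝒜 Φ) τ ∧ (∀ x : P, (⇑τ)^[p] x = x) ∧
      (∀ t' : Γ(V, W.1), (((DW.e.trans (zeroRingEquiv DW.𝒜 Φ)) ((ρ'.aut g₀⁻¹).hom.appLE W.1 W.1 (W.2.1 g₀⁻¹).ge t') : ↥(mapGrading DW.𝒜 Φ 0)) : P) =
        τ (((DW.e.trans (zeroRingEquiv DW.𝒜 Φ)) t' : ↥(mapGrading DW.𝒜 Φ 0)) : P)) := by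
  letI := DW.instCommRing
  letI := DW.instGradedRing
  letI := mapGradedRing DW.𝒜 Φ
  have hτeq : (conj Φ DW.σ : P ≃+* P) = τ := RingEquiv.ext fun x => (hτ x).symm
  have htameτ : IsTameNode p P (mapGrading DW.𝒜 Φ) τ := hτeq ▸ isTameNode_map DW.𝒜 Φ p DW.σ DW.tame
  refine ⟨htameτ, htameτ.2.2.2.2.2, fun t' => ?_⟩
  change Φ ((DW.e (actO ρ' W g₀ t') : ↥(DW.𝒜 0)) : DW.B) = τ (Φ ((DW.e t' : ↥(DW.𝒜 0)) : DW.B))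
  rw [DW.intertwine t', hτ, Φ.symm_apply_apply]

/-- ★★ **CENTRE PRODUCER, τ-form with separating sections.** See the module docstring. [OURS · L1 W4.5c · X-scheme move; NOT a statement of the manuscript] -/
theorem exists_isAdmissibleCentre_of_node_sections [Finite G] (hG : ∀ g : G, g ∈ Subgroup.zpowers g₀) (M : GModel p q G ρ g₀) [M.V.IsSeparated]
    (W : M.act.StableAffineOpens) (DW : NodeData p M.act g₀ W)
    {P : Type} [CommRing P] (Φ : letI := DW.instCommRing; DW.B ≃+* P) (τ : P ≃+* P)
    (hτ : letI := DW.instCommRing; ∀ x : P, τ x = Φ (DW.σ (Φ.symm x)))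
    {c : ℕ} (hc : 0 < c) (f : Fin c → P) (δ : Fin c → Π j : Fin DW.m, ZMod (DW.r j)) (w : Fin c → ℕ) (hw : ∀ i, 0 < w i)
    (hdeg : ∀ i, letI := DW.instCommRing; letI := DW.instGradedRing; f i ∈ mapGrading DW.𝒜 Φ (δ i))
    (hK1 : RingTheory.Sequence.IsRegular P (List.ofFn f)) (hK1' : IsRegularRing (P ⧸ Ideal.span (Set.range f)))
    (hσJ : ∀ n : ℕ, ((weightedFiltration f w).ideal n).map (τ : P →+* P) ≤ (weightedFiltration f w).ideal n)
    {ι : Type} (U : ι → M.V.Opens) (hcov : ∀ x : M.V, x ∈ W.1 ∨ ∃ i, x ∈ U i) (u : ι → Γ(M.V, W.1)) (nu : ι → ℕ) (hnu : ∀ i, 0 < nu i)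
    (hu : letI := DW.instCommRing; letI := DW.instGradedRing; ∀ i, Φ ((DW.e (u i) : ↥(DW.𝒜 0)) : DW.B) ∈ (weightedFiltration f w).ideal (nu i))
    (huU : ∀ i, ∀ v ∈ W.1, v ∈ U i → v ∈ M.V.basicOpen (u i)) :
    letI := DW.instCommRing; letI := DW.instGradedRing; letI := mapGradedRing DW.𝒜 Φ
    ∃ (𝒦 : ReesFiltration M.V) (d : ℕ), 0 < d ∧ IsAdmissibleCentre p M.act g₀ 𝒦 d ∧
      (∀ (g : G) (n : ℕ), (𝒦.ideal n).comap (M.act.aut g).hom = 𝒦.ideal n) ∧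
      (∀ n, (𝒦.filtration ⟨W.1, DW.affine⟩).ideal n =
        ((traceFiltration (mapGrading DW.𝒜 Φ) f w).ideal n).comap
          ((DW.e.trans (zeroRingEquiv DW.𝒜 Φ) : Γ(M.V, W.1) ≃+* ↥(mapGrading DW.𝒜 Φ 0)) : Γ(M.V, W.1) →+* ↥(mapGrading DW.𝒜 Φ 0))) ∧
      VeroneseNormalised (mapGrading DW.𝒜 Φ) f w d ∧
      (((𝒦.ideal d).support : Set M.V)) ⊆ (W.1 : Set M.V) := by
  classical
  letI := DW.instCommRing
  letI := DW.instGradedRing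
  letI := mapGradedRing DW.𝒜 Φ
  have hτeq : (conj Φ DW.σ : P ≃+* P) = τ := RingEquiv.ext fun x => (hτ x).symm
  have hσJc : ∀ n : ℕ, ((weightedFiltration f w).ideal n).map (conj Φ DW.σ : P →+* P) ≤ (weightedFiltration f w).ideal n := by rw [hτeq]; exact hσJ
  have hcl : ∀ n : ℕ, 0 < n →
      closure (M.V.zeroLocus (U := W.1)
          ((((traceFiltration (mapGrading DW.𝒜 Φ) f w).ideal n).comap
              ((DW.e.trans (zeroRingEquiv DW.𝒜 Φ) : Γ(M.V, W.1) ≃+* ↥(mapGrading DW.𝒜 Φ 0)) : Γ(M.V, W.1) →+* ↥(mapGrading DW.𝒜 Φ 0)) :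
            Ideal Γ(M.V, W.1)) : Set Γ(M.V, W.1)) ∩ (W.1 : Set M.V)) ⊆ (W.1 : Set M.V) := by
    intro n hn
    refine closure_zeroLocus_inter_subset_of_cover W.1 U hcov _ u (fun i => ⟨n, hn, ?_⟩) huU
    change (DW.e.trans (zeroRingEquiv DW.𝒜 Φ)) (u i ^ n) ∈ (traceFiltration (mapGrading DW.𝒜 Φ) f w).ideal n
    rw [mem_traceFiltration_iff, map_pow, SetLike.GradeZero.coe_pow]
    change (Φ ((DW.e (u i) : ↥(DW.𝒜 0)) : DW.B)) ^ n ∈ _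
    have h := Ideal.pow_mem_pow (hu i) n
    have hle := Veronese.idealFiltration_pow_le (weightedFiltration f w) (nu i) n
    exact (weightedFiltration f w).antitone (Nat.le_mul_of_pos_left n (hnu i)) (hle h)
  obtain ⟨𝒦, d, hd, hadm, -, hG𝒦, h𝒦O, hver, hsupp⟩ := exists_isAdmissibleCentre_of_node hG M W DW Φ hc f δ w hw hdeg hK1 hK1' hσJc hcl
  exact ⟨𝒦, d, hd, hadm, hG𝒦, h𝒦O, hver, hsupp⟩

/-- ★★ **ATLAS PRODUCER on a realisation, τ-form.** ✓`exists_moveAtlas_of_node` for the node `(P, Φ(DW.𝒜), τ, DW.e ≫ Φ|₀)`. [OURS · L1 W4.5c · X-scheme move] -/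
theorem exists_moveAtlas_of_node_tau [Finite G] (hp : 0 < p) (hG : ∀ g : G, g ∈ Subgroup.zpowers g₀) (M M' : GModel p q G ρ g₀)
    (𝔄 : NodeAtlasData p M.act g₀) (W : M.act.StableAffineOpens) (DW : NodeData p M.act g₀ W)
    {P : Type} [CommRing P] (Φ : letI := DW.instCommRing; DW.B ≃+* P) (τ : P ≃+* P)
    (hτ : letI := DW.instCommRing; ∀ x : P, τ x = Φ (DW.σ (Φ.symm x)))
    {c : ℕ} (f : Fin c → P) {δ : Fin c → Π j : Fin DW.m, ZMod (DW.r j)} (w : Fin c → ℕ)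
    (hf : ∀ i, letI := DW.instCommRing; letI := DW.instGradedRing; f i ∈ mapGrading DW.𝒜 Φ (δ i)) (hw : ∀ i, 0 < w i)
    (hK1 : RingTheory.Sequence.IsRegular P (List.ofFn f)) (hK1' : IsRegularRing (P ⧸ Ideal.span (Set.range f)))
    (hσJ : ∀ n : ℕ, ((weightedFiltration f w).ideal n).map (τ : P →+* P) ≤ (weightedFiltration f w).ideal n)
    (𝒦 : ReesFiltration M.V) (d : ℕ) (h𝒦G : ∀ (g : G) (n : ℕ), (𝒦.ideal n).comap (M.act.aut g).hom = 𝒦.ideal n)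
    (h𝒦O : letI := DW.instCommRing; letI := DW.instGradedRing; letI := mapGradedRing DW.𝒜 Φ; ∀ n, (𝒦.filtration ⟨W.1, DW.affine⟩).ideal n =
      ((traceFiltration (mapGrading DW.𝒜 Φ) f w).ideal n).comap
        ((DW.e.trans (zeroRingEquiv DW.𝒜 Φ) : Γ(M.V, W.1) ≃+* ↥(mapGrading DW.𝒜 Φ 0)) : Γ(M.V, W.1) →+* ↥(mapGrading DW.𝒜 Φ 0)))
    (hver : letI := DW.instCommRing; letI := DW.instGradedRing; letI := mapGradedRing DW.𝒜 Φ; VeroneseNormalised (mapGrading DW.𝒜 Φ) f w d)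
    (hsuppW : (((𝒦.ideal d).support : Set M.V)) ⊆ (W.1 : Set M.V))
    (π' : M'.V ⟶ M.V) (hbl : IsBlowup π' (𝒦.ideal d)) (hr : M'.r = π' ≫ M.r)
    (hcomm : ∀ g : G, (M'.act.aut g).hom ≫ π' = π' ≫ (M.act.aut g).hom)
    {k : ℕ} (hk : 0 < k) {L : ℕ} (y : letI := DW.instCommRing; letI := DW.instGradedRing; letI := mapGradedRing DW.𝒜 Φ; Fin L → ↥(mapGrading DW.𝒜 Φ 0))
    (hy : letI := DW.instCommRing; letI := DW.instGradedRing; letI := mapGradedRing DW.𝒜 Φ; ∀ j, y j ∈ (traceFiltration (mapGrading DW.𝒜 Φ) f w).ideal (d * k))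
    (hσy : letI := DW.instCommRing; letI := DW.instGradedRing; letI := mapGradedRing DW.𝒜 Φ; ∀ j, τ (y j : P) = y j)
    (hrad : letI := DW.instCommRing; letI := DW.instGradedRing; letI := mapGradedRing DW.𝒜 Φ;
      ∀ i : Fin c, cobordantAlgebra.u' f w i ∈ (Ideal.span (Set.range fun j => coverElement (mapGrading DW.𝒜 Φ) f w (d * k) (y j) (hy j))).radical)
    (g : ↥(cobordantAlgebra f w)) (hσp : ∀ x : P, (⇑τ)^[p] x = x) (h1 : augmentationIdeal (sigmaR τ f w hσJ hp hσp) ≤ Ideal.span {g})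
    (n : Fin L → ℕ) (z : letI := DW.instCommRing; letI := DW.instGradedRing; letI := mapGradedRing DW.𝒜 Φ; ∀ j, Fin (n j) → ChartRing (mapGrading DW.𝒜 Φ) f w (d * k) (y j) (hy j))
    (hz0 : letI := DW.instCommRing; letI := DW.instGradedRing; letI := mapGradedRing DW.𝒜 Φ; ∀ j l, z j l ∈ chartNodeGrading DW.r (mapGrading DW.𝒜 Φ) f w hf (d * k) (y j) (hy j) 0)
    (hzres : letI := DW.instCommRing; letI := DW.instGradedRing; letI := mapGradedRing DW.𝒜 Φ;
      ∀ j l, z j l ∈ ((augmentationIdeal (sigmaR τ f w hσJ hp hσp)).colon (Ideal.span {g})).map (algebraMap _ (ChartRing (mapGrading DW.𝒜 Φ) f w (d * k) (y j) (hy j)))) :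
    letI := DW.instCommRing; letI := DW.instGradedRing; letI := mapGradedRing DW.𝒜 Φ
    ∃ (O' : Fin L → M'.act.StableAffineOpens) (_ : ∀ j, IsAffineOpen (O' j).1)
      (_ : ∀ j, (O' j).1 = blowupChart π' ((𝒦.ideal d) ^ k) ⟨W.1, DW.affine⟩ ((DW.e.trans (zeroRingEquiv DW.𝒜 Φ)).symm (y j)))
      (E : ∀ j, letI := chartNodeGradedRing DW.r (mapGrading DW.𝒜 Φ) f w hf (d * k) (y j) (hy j);
        Γ(M'.V, (O' j).1) ≃+* ↥(chartNodeGrading DW.r (mapGrading DW.𝒜 Φ) f w hf (d * k) (y j) (hy j) 0)),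
      (∀ j, letI := chartNodeGradedRing DW.r (mapGrading DW.𝒜 Φ) f w hf (d * k) (y j) (hy j);
        IsTameNode p (ChartRing (mapGrading DW.𝒜 Φ) f w (d * k) (y j) (hy j)) (chartNodeGrading DW.r (mapGrading DW.𝒜 Φ) f w hf (d * k) (y j) (hy j))
          (sigmaChart (mapGrading DW.𝒜 Φ) f w (d * k) (y j) (hy j) τ hσJ hp hσp (hσy j))) ∧
      (∀ j, letI := chartNodeGradedRing DW.r (mapGrading DW.𝒜 Φ) f w hf (d * k) (y j) (hy j); ∀ t' : Γ(M'.V, (O' j).1),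
        ((E j ((M'.act.aut g₀⁻¹).hom.appLE (O' j).1 (O' j).1 ((O' j).2.1 g₀⁻¹).ge t') : ↥(chartNodeGrading DW.r (mapGrading DW.𝒜 Φ) f w hf (d * k) (y j) (hy j) 0)) :
            ChartRing (mapGrading DW.𝒜 Φ) f w (d * k) (y j) (hy j)) =
          sigmaChart (mapGrading DW.𝒜 Φ) f w (d * k) (y j) (hy j) τ hσJ hp hσp (hσy j)
            ((E j t' : ↥(chartNodeGrading DW.r (mapGrading DW.𝒜 Φ) f w hf (d * k) (y j) (hy j) 0)) : ChartRing (mapGrading DW.𝒜 Φ) f w (d * k) (y j) (hy j))) ∧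
      (∀ j (hle : (O' j).1 ≤ π' ⁻¹ᵁ W.1) (x : Γ(M.V, W.1)), letI := chartNodeGradedRing DW.r (mapGrading DW.𝒜 Φ) f w hf (d * k) (y j) (hy j);
        ((E j (π'.appLE W.1 (O' j).1 hle x) : ↥(chartNodeGrading DW.r (mapGrading DW.𝒜 Φ) f w hf (d * k) (y j) (hy j) 0)) : ChartRing (mapGrading DW.𝒜 Φ) f w (d * k) (y j) (hy j)) =
          toChartRing (mapGrading DW.𝒜 Φ) f w (d * k) (y j) (hy j) ((DW.e.trans (zeroRingEquiv DW.𝒜 Φ)) x)) ∧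
      ∃ 𝔄' : NodeAtlasData p M'.act g₀,
        𝔄'.fLocus ⊆ π'.base ⁻¹' (𝔄.fLocus \ (W.1 : Set M.V)) ∪
          ⋃ j, ((O' j).1 : Set M'.V) ∩ {v | ∀ l, letI := chartNodeGradedRing DW.r (mapGrading DW.𝒜 Φ) f w hf (d * k) (y j) (hy j);
            v ∉ M'.V.basicOpen ((E j).symm ⟨z j l, hz0 j l⟩)} := by
  letI := DW.instCommRing
  letI := DW.instGradedRing
  letI := mapGradedRing DW.𝒜 Φ
  obtain ⟨htame, -, hσL⟩ := node_tau_facts W DW Φ τ hτ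
  exact exists_moveAtlas_of_node hp hG M M' 𝔄 W DW.affine DW.r (mapGrading DW.𝒜 Φ) f w hf τ (DW.e.trans (zeroRingEquiv DW.𝒜 Φ)) htame hσp hσL hw hK1 hK1' hσJ
    𝒦 d h𝒦G h𝒦O hver hsuppW π' hbl hr hcomm hk y hy hσy hrad g h1 n z hz0 hzres

end Summit.ResolutionOfSingularities.ResolutionOfSingularities.Theorems.WildQuotientResolution.S1.GameFrame.GModel

end
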